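import Summits.ResolutionOfSingularities.ResolutionOfSingularities.Theorems.WeightedInvariantOrderNonIncrease
import HarnessLib

/-!
# «ν does not rise» — consumer form: the hypothesis «the weighted initial form of `f` contains the monomial `u^α` with a
# unit coefficient» as ONE membership `f − c·u^α ∈ (u^β : w·β ≥ ℓ, β ≠ α)` (ORDER (o33-a), wrapper)

Topic: `Summits/ResolutionOfSingularities/ResolutionOfSingularities/Theorems`. Helper for the door item
`HypersurfaceCentreConstruction` (statement `stmt-ResolutionOfSingularities-19897`, route `WeightedInvariant`), line
`local-engine` of res-L1-w43-plan-1 (L W4.3), ORDER (o33-a) of `IOTA3-DESIGN.md` v1 §5: a WRAPPER turning the natural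
hypothesis of the TAKING line (2026-08-27T11:36:59Z) —

  `∃ c, IsUnit c ∧ f − c · ∏ uᵢ^{αᵢ} ∈ Ideal.span {∏ uᵢ^{βᵢ} | ℓ ≤ w·β ∧ β ≠ α}`, with `w·α = ℓ`

(«the weight-`ℓ` initial form of `f` contains the monomial `u^α` with a UNIT coefficient»; the ideal contains the deeper
piece `𝒥_{ℓ+1}`) — into the finite-sum data `f = Σ_{β∈Δ} a_β u^β` consumed by
`OrderNonIncrease.adicOrder_transform_le_of_isUnit_coeff` (p530559): `exists_finset_repr_of_sub_mem_span` (pure bookkeeping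
in a commutative ring: unpack the span membership into a finite combination, regroup by exponent), and the headline
**`adicOrder_le_of_sub_mem_span` / `iotaOrd_le_of_sub_mem_span`**: at every prime `𝔫 ∋ t⁻¹` of the cobordant algebra of a
point / flag centre (`u` a regular system of parameters, all weights positive) and for every factorisation
`f = (t⁻¹)^a g`, `t⁻¹ ∤ g`: `ord_{B_𝔫} g ≤ Σ αᵢ`.

[OURS · L1 W4.3] Replaces the role of NO printed item; NOT a statement of the manuscript
[claim: Hironaka2017, status: under-review]. AI work, weaker than expert review.

## References

* J. Włodarczyk, *Functorial resolution by torus actions*, arXiv:2203.03090, Lemma 4.1.7. [Wlodarczyk2022]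
* res-L1-w43-plan-1, `IOTA3-DESIGN.md` v1 §5 ORDER (o33-a) (OURS, AI planning).
-/

noncomputable section

open IsLocalRing Literature.AlgebraicGeometry.Resolution
open Summit.ResolutionOfSingularities.ResolutionOfSingularities.Cruxes.HypersurfaceCentreConstruction.LocalEngine (iotaOrd)

set_option linter.dupNamespace false -- mandated namespace of this single-conjunct summit

namespace Summit.ResolutionOfSingularities.ResolutionOfSingularities.Theorems.OrderNonIncrease

variable {S : Type} [CommRing S] {d : ℕ}

/-! ## Unpacking the span membership into a finite sum over exponents -/

/-- **Finite-sum form of «`f ≡ c·u^α` modulo the other monomials of weight `≥ ℓ`»**: if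
`f − c·u^α ∈ Ideal.span {u^β | ℓ ≤ w·β ∧ β ≠ α}` then `f = Σ_{β∈Δ} a_β u^β` for a finite set of exponents `Δ ∋ α` with
`a_α = c` and `ℓ ≤ w·β` for every `β ∈ Δ ∖ {α}`. [folklore] -/
theorem exists_finset_repr_of_sub_mem_span (u : Fin d → S) (w : Fin d → ℕ) (ℓ : ℕ) (α : Fin d → ℕ) (c : S)
    {f : S} (hf : f - c * ∏ i, u i ^ α i ∈
      Ideal.span {m : S | ∃ β : Fin d → ℕ, ℓ ≤ ∑ i, w i * β i ∧ β ≠ α ∧ m = ∏ i, u i ^ β i}) :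
    ∃ (Δ : Finset (Fin d → ℕ)) (a : (Fin d → ℕ) → S), α ∈ Δ ∧ a α = c ∧
      (∀ β ∈ Δ, β ≠ α → ℓ ≤ ∑ i, w i * β i) ∧ f = ∑ β ∈ Δ, a β * ∏ i, u i ^ β i := by
  classical
  obtain ⟨n, coef, g, hsum⟩ := Submodule.mem_span_set'.mp hf
  -- the exponent of each generator
  have hg : ∀ i, ∃ β : Fin d → ℕ, ℓ ≤ ∑ j, w j * β j ∧ β ≠ α ∧ ((g i : S) = ∏ j, u j ^ β j) := fun i => (g i).2
  choose βf hβℓ hβne hβeq using hg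
  set a : (Fin d → ℕ) → S := fun γ =>
    if γ = α then c else ∑ i ∈ Finset.univ.filter (fun i => βf i = γ), coef i with ha
  have haα : a α = c := by simp [a]
  have hα : α ∉ Finset.univ.image βf := by
    intro h
    obtain ⟨i, -, hi⟩ := Finset.mem_image.mp h
    exact hβne i hi
  have haγ : ∀ γ ∈ Finset.univ.image βf, a γ = ∑ i ∈ Finset.univ.filter (fun i => βf i = γ), coef i := by
    intro γ hγ
    have hγα : γ ≠ α := fun h => hα (h ▸ hγ)
    simp [a, hγα]
  refine ⟨insert α (Finset.univ.image βf), a, Finset.mem_insert_self _ _, haα, ?_, ?_⟩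
  · intro β hβ hne
    rcases Finset.mem_insert.mp hβ with rfl | hβ'
    · exact absurd rfl hne
    · obtain ⟨i, -, rfl⟩ := Finset.mem_image.mp hβ'
      exact hβℓ i
  · rw [Finset.sum_insert hα, haα]
    have hrest : ∑ γ ∈ Finset.univ.image βf, a γ * ∏ j, u j ^ γ j = ∑ i, coef i * ∏ j, u j ^ βf i j := by
      rw [← Finset.sum_fiberwise_of_maps_to (s := Finset.univ) (t := Finset.univ.image βf) (g := βf)
        (fun i _ => Finset.mem_image_of_mem βf (Finset.mem_univ i))]
      refine Finset.sum_congr rfl fun γ hγ => ?_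
      rw [haγ γ hγ, Finset.sum_mul]
      refine Finset.sum_congr rfl fun i hi => ?_
      rw [(Finset.mem_filter.mp hi).2]
    have hsum' : ∑ i, coef i * ∏ j, u j ^ βf i j = f - c * ∏ i, u i ^ α i := by
      rw [← hsum]
      refine Finset.sum_congr rfl fun i _ => ?_
      rw [smul_eq_mul, hβeq i]
    rw [hrest, hsum']
    ring

/-! ## The order bound from the span hypothesis (point / flag centres) -/

section Successor

variable [IsRegularLocalRing S] (u : Fin d → S) (w : Fin d → ℕ) (hu : Ideal.span (Set.range u) = maximalIdeal S)
  (hd : (maximalIdeal S).spanFinrank = d) (hw : ∀ i, 0 < w i)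

include hu hd hw

/-- **(o33-a) «ν does not rise», span form, `adicOrder`.**  `S` regular local, `u` a regular system of parameters with
positive weights `w`, `α` an exponent of weight `w·α = ℓ`, `c` a unit with `f − c·u^α ∈ (u^β : ℓ ≤ w·β, β ≠ α)`.  Then at
every prime `𝔫 ∋ t⁻¹` of the cobordant algebra and for every factorisation `f = (t⁻¹)^a g`, `t⁻¹ ∤ g`:
`ord_{B_𝔫} g ≤ Σ αᵢ`. [OURS · L1 W4.3 · ORDER (o33-a)] [cite: Wlodarczyk2022, Lemma 4.1.7] -/
theorem adicOrder_le_of_sub_mem_span {f c : S} (hc : IsUnit c) (α : Fin d → ℕ) {ℓ : ℕ} (hwα : ∑ i, w i * α i = ℓ)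
    (hf : f - c * ∏ i, u i ^ α i ∈
      Ideal.span {m : S | ∃ β : Fin d → ℕ, ℓ ≤ ∑ i, w i * β i ∧ β ≠ α ∧ m = ∏ i, u i ^ β i})
    (𝔫 : Ideal (extReesAlgebra (weightedMonomialIdeal u w))) [𝔫.IsPrime]
    (hT : extReesAlgebra.tInv (weightedMonomialIdeal u w) ∈ 𝔫)
    {a' : ℕ} {g : extReesAlgebra (weightedMonomialIdeal u w)}
    (hfg : algebraMap S (extReesAlgebra (weightedMonomialIdeal u w)) f =
      extReesAlgebra.tInv (weightedMonomialIdeal u w) ^ a' * g)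
    (hndvd : ¬ extReesAlgebra.tInv (weightedMonomialIdeal u w) ∣ g) :
    adicOrder (algebraMap _ (Localization.AtPrime 𝔫) g) ≤ ((∑ i, α i : ℕ) : ℕ∞) := by
  obtain ⟨Δ, a, hαΔ, haα, hΔ, hfΔ⟩ := exists_finset_repr_of_sub_mem_span u w ℓ α c hf
  have hm : ∀ β ∈ Δ, ℓ ≤ ∑ i, w i * β i := fun β hβ => by
    by_cases h : β = α
    · rw [h, hwα]
    · exact hΔ β hβ h
  have hr : (0 : S) ∈ (maximalIdeal S) ^ (ℓ + 1) := Ideal.zero_mem _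
  exact adicOrder_transform_le_of_isUnit_coeff u w hu hd hw Δ a ℓ (Nat.succ_pos ℓ) hr hm (Nat.lt_succ_self ℓ)
    (by rw [hfΔ, add_zero]) hαΔ hwα (haα ▸ hc) 𝔫 hT hfg hndvd

/-- **(o33-a) «ν does not rise», span form, `iotaOrd`.** [OURS · L1 W4.3 · ORDER (o33-a)]
[cite: Wlodarczyk2022, Lemma 4.1.7] -/
theorem iotaOrd_le_of_sub_mem_span {f c : S} (hc : IsUnit c) (α : Fin d → ℕ) {ℓ : ℕ} (hwα : ∑ i, w i * α i = ℓ)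
    (hf : f - c * ∏ i, u i ^ α i ∈
      Ideal.span {m : S | ∃ β : Fin d → ℕ, ℓ ≤ ∑ i, w i * β i ∧ β ≠ α ∧ m = ∏ i, u i ^ β i})
    (𝔫 : Ideal (extReesAlgebra (weightedMonomialIdeal u w))) [𝔫.IsPrime]
    (hT : extReesAlgebra.tInv (weightedMonomialIdeal u w) ∈ 𝔫)
    {a' : ℕ} {g : extReesAlgebra (weightedMonomialIdeal u w)}
    (hfg : algebraMap S (extReesAlgebra (weightedMonomialIdeal u w)) f =
      extReesAlgebra.tInv (weightedMonomialIdeal u w) ^ a' * g)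
    (hndvd : ¬ extReesAlgebra.tInv (weightedMonomialIdeal u w) ∣ g) :
    iotaOrd (Localization.AtPrime 𝔫) (algebraMap _ (Localization.AtPrime 𝔫) g) ≤ ((∑ i, α i : ℕ) : Ordinal) := by
  obtain ⟨Δ, a, hαΔ, haα, hΔ, hfΔ⟩ := exists_finset_repr_of_sub_mem_span u w ℓ α c hf
  have hm : ∀ β ∈ Δ, ℓ ≤ ∑ i, w i * β i := fun β hβ => by
    by_cases h : β = α
    · rw [h, hwα]
    · exact hΔ β hβ h
  have hr : (0 : S) ∈ (maximalIdeal S) ^ (ℓ + 1) := Ideal.zero_mem _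
  exact iotaOrd_transform_le_of_isUnit_coeff u w hu hd hw Δ a ℓ (Nat.succ_pos ℓ) hr hm (Nat.lt_succ_self ℓ)
    (by rw [hfΔ, add_zero]) hαΔ hwα (haα ▸ hc) 𝔫 hT hfg hndvd

end Successor

end Summit.ResolutionOfSingularities.ResolutionOfSingularities.Theorems.OrderNonIncrease
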